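import Mathlib
import Literature.Topology.FourManifolds.GroupTrisections

/-!
# drefute evidence: the three DEF-FREE absorption stubs 2a–2c of the reshaped line
`power-twist-absorption` (lead cycle 1) are TRUE — complete proofs with the stub types VERBATIM

`transvectionPowCongruent  : <type of stub_transvectionPowCongruent>`
`partialConjPowCongruent   : <type of stub_partialConjPowCongruent>`
`conjOnClosure             : <type of stub_conjOnClosure>`

(crux stmt-SmoothPoincare4-14593; refuter seat refuter-drefute-stmt-SmoothPoincare4-14593-0, 2026-08-16.
Positive lemmas: attached as item evidence for the lead / stub workers, not landed by the refuter.)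
-/

set_option linter.dupNamespace false

noncomputable section

namespace Summit.SmoothPoincare4.SmoothPoincare4.Cruxes.ShadowsStandard.PowerTwistAbsorption.Pieces

open Literature.Topology.FourManifolds Subgroup

/-- Generator criterion at any genus: for NORMAL `M`, `φ(x)x⁻¹ ∈ M` on the standard generators
implies it for all `s`. -/
theorem congruent_of_generators {g : ℕ} {M : Subgroup (SurfaceGroup g)} [M.Normal]
    {φ : SurfaceGroup g ≃* SurfaceGroup g}
    (h : ∀ x : surfaceGen g, φ (PresentedGroup.of x) * (PresentedGroup.of x)⁻¹ ∈ M) :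
    ∀ s : SurfaceGroup g, φ s * s⁻¹ ∈ M := by
  let H : Subgroup (SurfaceGroup g) :=
    { carrier := {s | φ s * s⁻¹ ∈ M}
      mul_mem' := by
        intro s t hs ht
        have e : φ (s * t) * (s * t)⁻¹ = (φ s * s⁻¹) * (s * (φ t * t⁻¹) * s⁻¹) := by
          rw [map_mul]; group
        change φ (s * t) * (s * t)⁻¹ ∈ M
        rw [e]
        exact M.mul_mem hs (Subgroup.Normal.conj_mem inferInstance _ ht s)
      one_mem' := by
        change φ 1 * (1 : SurfaceGroup g)⁻¹ ∈ M
        simp [M.one_mem]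
      inv_mem' := by
        intro s hs
        change φ s⁻¹ * s⁻¹⁻¹ ∈ M
        have h1 : s * (φ s)⁻¹ ∈ M := by simpa using M.inv_mem hs
        have h2 : s⁻¹ * (s * (φ s)⁻¹) * s⁻¹⁻¹ ∈ M :=
          Subgroup.Normal.conj_mem inferInstance _ h1 s⁻¹
        simpa [map_inv, mul_assoc] using h2 }
  intro s
  exact PresentedGroup.generated_by _ H h s

/-! ## 2a  `stub_transvectionPowCongruent` -/

section transvection

variable {g : ℕ} {i : Fin g} {T : SurfaceGroup g ≃* SurfaceGroup g}
  (hT : ∀ x : surfaceGen g, T (PresentedGroup.of x) =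
    if x = (i, true) then PresentedGroup.of (i, true) * PresentedGroup.of (i, false)
    else PresentedGroup.of x)
include hT

theorem transvection_pow_apply_of_ne (e : ℕ) {x : surfaceGen g} (hx : x ≠ (i, true)) :
    (T ^ e) (PresentedGroup.of x) = PresentedGroup.of x := by
  induction e with
  | zero => simp
  | succ n ih => rw [pow_succ, MulAut.mul_apply, hT x, if_neg hx, ih]

theorem transvection_pow_apply_self (e : ℕ) :
    (T ^ e) (PresentedGroup.of (i, true)) =
      PresentedGroup.of (i, true) * PresentedGroup.of (i, false) ^ e := by
  induction e with
  | zero => simp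
  | succ n ih =>
    have hne : ((i, false) : surfaceGen g) ≠ (i, true) := by simp
    rw [pow_succ, MulAut.mul_apply, hT (i, true), if_pos rfl, map_mul, ih,
      transvection_pow_apply_of_ne hT n hne, pow_succ, mul_assoc]

end transvection

/-- **STUB 2a, proved** (type verbatim). -/
theorem transvectionPowCongruent :
    ∀ (g e : ℕ) (i : Fin g) (M : Subgroup (SurfaceGroup g)), M.Normal →
      ∀ T : SurfaceGroup g ≃* SurfaceGroup g,
      (∀ x : surfaceGen g, T (PresentedGroup.of x) =
          if x = (i, true) then PresentedGroup.of (i, true) * PresentedGroup.of (i, false)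
          else PresentedGroup.of x) →
      (PresentedGroup.of (i, false) : SurfaceGroup g) ^ e ∈ M →
      ∀ s : SurfaceGroup g, (T ^ e) s * s⁻¹ ∈ M := by
  intro g e i M hM T hT he
  haveI : M.Normal := hM
  refine congruent_of_generators ?_
  intro x
  by_cases hx : x = (i, true)
  · subst hx
    rw [transvection_pow_apply_self hT e]
    exact Subgroup.Normal.conj_mem inferInstance _ he _
  · rw [transvection_pow_apply_of_ne hT e hx, mul_inv_cancel]
    exact M.one_mem

/-! ## 2b  `stub_partialConjPowCongruent` -/

section partialConj

variable {g : ℕ} {P : surfaceGen g → Prop} [DecidablePred P] {w : SurfaceGroup g}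
  {T : SurfaceGroup g ≃* SurfaceGroup g}

theorem partialConj_pow_apply_w (hw : T w = w) (n : ℕ) : (T ^ n) w = w := by
  induction n with
  | zero => simp
  | succ n ih => rw [pow_succ, MulAut.mul_apply, hw, ih]

variable (hT : ∀ x : surfaceGen g, T (PresentedGroup.of x) =
    if P x then w * PresentedGroup.of x * w⁻¹ else PresentedGroup.of x)
include hT

theorem partialConj_pow_apply_of_not (n : ℕ) {x : surfaceGen g} (hx : ¬ P x) :
    (T ^ n) (PresentedGroup.of x) = PresentedGroup.of x := by
  induction n with
  | zero => simp
  | succ n ih => rw [pow_succ, MulAut.mul_apply, hT x, if_neg hx, ih]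

theorem partialConj_pow_apply_of (hw : T w = w) (n : ℕ) {x : surfaceGen g} (hx : P x) :
    (T ^ n) (PresentedGroup.of x) = w ^ n * PresentedGroup.of x * (w ^ n)⁻¹ := by
  induction n with
  | zero => simp
  | succ n ih =>
    rw [pow_succ, MulAut.mul_apply, hT x, if_pos hx, map_mul, map_mul, map_inv,
      partialConj_pow_apply_w hw n, ih, pow_succ', mul_inv_rev]
    group

end partialConj

/-- **STUB 2b, proved** (type verbatim). -/
theorem partialConjPowCongruent :
    ∀ (g e : ℕ) (P : surfaceGen g → Prop) [DecidablePred P] (w : SurfaceGroup g)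
      (M : Subgroup (SurfaceGroup g)), M.Normal →
      ∀ T : SurfaceGroup g ≃* SurfaceGroup g,
      (∀ x : surfaceGen g, T (PresentedGroup.of x) =
          if P x then w * PresentedGroup.of x * w⁻¹ else PresentedGroup.of x) →
      T w = w → w ^ e ∈ M →
      ∀ s : SurfaceGroup g, (T ^ e) s * s⁻¹ ∈ M := by
  intro g e P _ w M hM T hT hw he
  haveI : M.Normal := hM
  refine congruent_of_generators ?_
  intro x
  by_cases hx : P x
  · rw [partialConj_pow_apply_of hT hw e hx]
    have h2 : PresentedGroup.of x * (w ^ e)⁻¹ * (PresentedGroup.of x)⁻¹ ∈ M :=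
      Subgroup.Normal.conj_mem inferInstance _ (M.inv_mem he) _
    have h3 := M.mul_mem he h2
    simpa [mul_assoc] using h3
  · rw [partialConj_pow_apply_of_not hT e hx, mul_inv_cancel]
    exact M.one_mem

/-! ## 2c  `stub_conjOnClosure` -/

/-- **STUB 2c, proved** (type verbatim): `T` is conjugation by `w` on the subgroup generated by the
generators on which it is. -/
theorem conjOnClosure :
    ∀ (g : ℕ) (P : surfaceGen g → Prop) (w : SurfaceGroup g) (T : SurfaceGroup g ≃* SurfaceGroup g),
      (∀ x : surfaceGen g, P x → T (PresentedGroup.of x) = w * PresentedGroup.of x * w⁻¹) →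
      ∀ s ∈ Subgroup.closure ((fun x : surfaceGen g => (PresentedGroup.of x : SurfaceGroup g)) '' {x | P x}),
        T s = w * s * w⁻¹ := by
  intro g P w T hT s hs
  let H : Subgroup (SurfaceGroup g) :=
    { carrier := {s | T s = w * s * w⁻¹}
      mul_mem' := by
        intro s t hs ht
        change T (s * t) = w * (s * t) * w⁻¹
        change T s = w * s * w⁻¹ at hs
        change T t = w * t * w⁻¹ at ht
        rw [map_mul, hs, ht]; group
      one_mem' := by
        change T 1 = w * 1 * w⁻¹
        simp
      inv_mem' := by
        intro s hs
        change T s⁻¹ = w * s⁻¹ * w⁻¹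
        change T s = w * s * w⁻¹ at hs
        rw [map_inv, hs]; group }
  have hle : Subgroup.closure
      ((fun x : surfaceGen g => (PresentedGroup.of x : SurfaceGroup g)) '' {x | P x}) ≤ H := by
    rw [Subgroup.closure_le]
    rintro _ ⟨x, hx, rfl⟩
    change T (PresentedGroup.of x) = w * PresentedGroup.of x * w⁻¹
    exact hT x hx
  exact hle hs

end Summit.SmoothPoincare4.SmoothPoincare4.Cruxes.ShadowsStandard.PowerTwistAbsorption.Pieces

end
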